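import Literature.Computability.Complexity.StringSwap
import HarnessLib

/-!
# `FP` is closed under finite patching (changing the values on inputs of bounded length)

Trunk `CplxCore`, toolkit for `TimeBounds.lean`. If `f ∈ FP` and `g` agrees with `f` on all
inputs of length `≥ n₀`, then `g ∈ FP` (`mem_FP_of_eqOn_le`): the finitely many exceptional
inputs are handled by the finite control. This is the machine-level form of "we may hardwire the
values … for `n < n₀`" (Raz–Tal, J. ACM 69 (2022), App. A, for the `BQP^O` machine; in general:
Arora–Barak 2009, §1.3, Claim 1.5/1.6 spirit, and §6.2 — a uniform family may be modified on
finitely many lengths), assembled — as in `StringCopy.lean` — from the `FinTM2` toolkit without a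
new machine: copy the input (`copyFn : z ↦ ⟨z, z⟩`), run `f` on the second copy
(`mapSndFn`), and let a finite-state transducer (`Transducers.lean`) read the first copy into its
state (up to `n₀` symbols) while copying the second to the output; at the end of the input it
keeps the body `f z` if it has read `n₀` symbols, and otherwise discards it and outputs the
hard-wired `g z` (`patchT`, `patchT_eval_boolPair`).

## References

* S. Arora, B. Barak, *Computational Complexity: A Modern Approach*, CUP 2009, §1.3, §6.2.
* R. Raz, A. Tal, *Oracle separation of BQP and PH*, J. ACM 69 (2022), App. A ("Fixing the
  oracle `O`, we may hardwire the values of `L` on `1ⁿ` for `n < n₀` to `M`") [RazTalJACM2022].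
* J. E. Hopcroft, J. D. Ullman, *Introduction to Automata Theory, Languages, and Computation*,
  1979, §2.7 (Mealy machines).
-/

namespace Literature.Computability.Complexity

open _root_.Computability StrCopy

namespace Patch

variable (n₀ : ℕ)

/-! ### The patching transducer -/

/-- States of the patching transducer: the phase (`false`: reading the doubled first component,
`true`: copying the second component), a pending symbol of the current pair, the number `k ≤ n₀`
of bits of the first component read so far, and those bits. [folklore] -/
structure PState (n₀ : ℕ) where
  /-- `false` while reading the first component, `true` while copying the second -/
  phase : Bool
  /-- the first symbol of the current pair, if any -/
  pend : Option Bool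
  /-- the number of bits stored (saturates at `n₀`) -/
  cnt : Fin (n₀ + 1)
  /-- the stored bits (positions `< cnt` are meaningful) -/
  bits : Fin n₀ → Bool
  deriving DecidableEq, Fintype

variable {n₀}

/-- The stored prefix of the first component. [folklore] -/
def PState.pref (s : PState n₀) : List Bool := (List.ofFn s.bits).take s.cnt

/-- Storing one more bit (no effect once `n₀` bits are stored). [folklore] -/
def PState.pushBit (s : PState n₀) (a : Bool) : PState n₀ :=
  if h : (s.cnt : ℕ) < n₀ then
    { s with pend := none, cnt := ⟨s.cnt + 1, by omega⟩, bits := Function.update s.bits ⟨s.cnt, h⟩ a }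
  else { s with pend := none }

variable (n₀) (g : List Bool → List Bool)

/-- **The patching transducer.** Reading phase: symbols come in pairs; an equal pair `aa` is a bit
`a` of the first component (stored while fewer than `n₀` are stored), an unequal pair is the
separator and starts the copying phase, which emits every further symbol. At the end: keep the
emitted body iff `n₀` bits were stored; otherwise output `g` of the stored prefix.
[Hopcroft–Ullman 1979, §2.7] [folklore] -/
def patchT : FST (PState n₀) Bool Bool where
  init := ⟨false, none, 0, fun _ => false⟩
  step s a :=
    if s.phase then (s, [a])
    else match s.pend with
      | none => ({ s with pend := some a }, [])
      | some p => if p = a then (s.pushBit a, []) else ({ s with phase := true, pend := none }, [])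
  front s := if (s.cnt : ℕ) < n₀ then g s.pref else []
  keep s := decide ((s.cnt : ℕ) = n₀)

variable {n₀ g}

/-- In the copying phase the transducer copies. [folklore] -/
theorem run_copy (s : PState n₀) (hs : s.phase = true) (w : List Bool) :
    (patchT n₀ g).run s w = (s, w) := by
  induction w with
  | nil => rfl
  | cons a w ih =>
    rw [FST.run_cons]
    have hstep : (patchT n₀ g).step s a = (s, [a]) := by simp [patchT, hs]
    rw [hstep, ih]
    rfl

/-- Reading one doubled bit stores it. [folklore] -/
theorem run_pair (s : PState n₀) (hs : s.phase = false) (hp : s.pend = none) (a : Bool) (w : List Bool) :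
    (patchT n₀ g).run s (a :: a :: w) = (patchT n₀ g).run (s.pushBit a) w := by
  rw [FST.run_cons, FST.run_cons]
  have h1 : (patchT n₀ g).step s a = ({ s with pend := some a }, []) := by simp [patchT, hs, hp]
  rw [h1]
  have h2 : (patchT n₀ g).step { s with pend := some a } a = (s.pushBit a, []) := by
    simp [patchT, hs, PState.pushBit]
  simp only [h2, List.nil_append]

/-- `pushBit` keeps the reading phase and clears the pending symbol. [folklore] -/
theorem pushBit_phase (s : PState n₀) (a : Bool) : (s.pushBit a).phase = s.phase ∧ (s.pushBit a).pend = none := by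
  unfold PState.pushBit; split <;> simp

/-- Prefixes of `List.ofFn` only depend on the first values. [folklore] -/
theorem take_ofFn_congr {k m : ℕ} {f f' : Fin m → Bool} (h : ∀ i : Fin m, (i : ℕ) < k → f i = f' i) :
    (List.ofFn f).take k = (List.ofFn f').take k := by
  apply List.ext_getElem
  · simp
  · intro i h1 h2
    simp only [List.getElem_take, List.getElem_ofFn]
    simp only [List.length_take, List.length_ofFn] at h1
    exact h _ (by simp only; omega)

/-- `pushBit` below saturation: count and prefix. [folklore] -/
theorem pushBit_pref (s : PState n₀) (a : Bool) (h : (s.cnt : ℕ) < n₀) :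
    ((s.pushBit a).cnt : ℕ) = s.cnt + 1 ∧ (s.pushBit a).pref = s.pref ++ [a] := by
  unfold PState.pushBit
  rw [dif_pos h]
  refine ⟨rfl, ?_⟩
  unfold PState.pref
  simp only
  rw [List.take_add_one, List.getElem?_ofFn, dif_pos h]
  congr 1
  · exact take_ofFn_congr fun i hi => Function.update_of_ne (fun e => (Nat.ne_of_lt hi) (congrArg Fin.val e)) _ _
  · simp

/-- `pushBit` at saturation: the count stays `n₀`. [folklore] -/
theorem pushBit_cnt_of_le (s : PState n₀) (a : Bool) (h : n₀ ≤ (s.cnt : ℕ)) : ((s.pushBit a).cnt : ℕ) = s.cnt := by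
  unfold PState.pushBit; rw [dif_neg (by omega)]

/-- **Reading the doubled first component**: no emission, the phase is kept, the count becomes
`min n₀ (cnt + |w|)`, and if this does not saturate the prefix is extended by `w`. [folklore] -/
theorem run_dup (w : List Bool) : ∀ (s : PState n₀), s.phase = false → s.pend = none →
    ((patchT n₀ g).run s (dup w)).2 = [] ∧ ((patchT n₀ g).run s (dup w)).1.phase = false ∧
      ((patchT n₀ g).run s (dup w)).1.pend = none ∧
      (((patchT n₀ g).run s (dup w)).1.cnt : ℕ) = min n₀ (s.cnt + w.length) ∧
      ((s.cnt : ℕ) + w.length ≤ n₀ → ((patchT n₀ g).run s (dup w)).1.pref = s.pref ++ w) := by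
  induction w with
  | nil =>
    intro s hs hp
    have := s.cnt.isLt
    exact ⟨rfl, hs, hp, by simp [dup]; omega, fun _ => by simp [dup]⟩
  | cons a w ih =>
    intro s hs hp
    rw [show dup (a :: w) = a :: a :: dup w by simp [dup], run_pair s hs hp]
    obtain ⟨hph, hpe⟩ := pushBit_phase s a
    obtain ⟨h1, h2, h3, h4, h5⟩ := ih (s.pushBit a) (hph.trans hs) hpe
    refine ⟨h1, h2, h3, ?_, fun hle => ?_⟩
    · rw [h4]
      by_cases hc : (s.cnt : ℕ) < n₀
      · rw [(pushBit_pref s a hc).1]; simp only [List.length_cons]; omega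
      · rw [pushBit_cnt_of_le s a (by omega)]; simp only [List.length_cons]; omega
    · simp only [List.length_cons] at hle
      obtain ⟨hc1, hc2⟩ := pushBit_pref s a (by omega)
      rw [h5 (by rw [hc1]; omega), hc2, List.append_assoc]
      rfl

/-- **The patching transducer on a pair**: `⟨z, y⟩ ↦ y` if `|z| ≥ n₀`, `↦ g z` if `|z| < n₀`.
[Hopcroft–Ullman 1979, §2.7] [folklore] -/
theorem patchT_eval_boolPair (z y : List Bool) :
    (patchT n₀ g).eval (boolPair z y) = if z.length < n₀ then g z else y := by
  rw [boolPair_eq_dup, FST.eval, FST.run_append]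
  obtain ⟨h1, h2, h3, h4, h5⟩ := run_dup (g := g) z (patchT n₀ g).init rfl rfl
  set s₁ := ((patchT n₀ g).run (patchT n₀ g).init (dup z)).1 with hs₁
  -- the separator
  have e1 : (patchT n₀ g).step s₁ false = ({ s₁ with pend := some false }, []) := by simp [patchT, h2, h3]
  have e2 : (patchT n₀ g).step { s₁ with pend := some false } true = ({ s₁ with phase := true, pend := none }, []) := by
    simp [patchT, h2]
  have hsep : (patchT n₀ g).run s₁ (false :: true :: y) = ({ s₁ with phase := true, pend := none }, y) := by
    simp only [FST.run_cons, e1, e2, List.nil_append]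
    rw [run_copy _ rfl]
  rw [hsep, h1, List.nil_append]
  have h0 : ((patchT n₀ g).init.cnt : ℕ) = 0 := rfl
  have hp0 : (patchT n₀ g).init.pref = [] := by simp [PState.pref, patchT]
  simp only [h0, Nat.zero_add, hp0, List.nil_append] at h4 h5
  change (if ((s₁.cnt : ℕ) < n₀) then g s₁.pref else []) ++ (if decide ((s₁.cnt : ℕ) = n₀) = true then y else []) = _
  by_cases hz : z.length < n₀
  · rw [if_pos hz, if_pos (by rw [h4]; omega), h5 hz.le, if_neg (by rw [h4]; simp; omega), List.append_nil]
  · rw [if_neg hz, if_neg (by rw [h4]; omega), if_pos (by rw [h4]; simp; omega), List.nil_append]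

end Patch

/-- The patched function as a pipeline: copy, `f` on the second copy, the transducer. [folklore] -/
theorem patchT_eval_mapSndFn_copyFn (n₀ : ℕ) (f g : List Bool → List Bool) (z : List Bool) :
    (Patch.patchT n₀ g).eval (mapSndFn f (copyFn z)) = if z.length < n₀ then g z else f z := by
  rw [copyFn_apply, mapSndFn_boolPair, Patch.patchT_eval_boolPair]

/-- **`FP` is closed under finite patching.** If `f ∈ FP` and `g` agrees with `f` on every input of
length at least `n₀`, then `g ∈ FP`. [Arora–Barak 2009, §1.3 and §6.2; Raz–Tal 2022, App. A
("we may hardwire the values … for n < n₀")] [cite: RazTalJACM2022, App. A] -/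
theorem mem_FP_of_eqOn_le {f g : List Bool → List Bool} (hf : f ∈ FP) (n₀ : ℕ)
    (hfg : ∀ z, n₀ ≤ z.length → g z = f z) : g ∈ FP := by
  have hT : (Patch.patchT n₀ g).eval ∈ FP := (Patch.patchT n₀ g).polyTimeComputable_eval
  have h := comp_mem_FP hT (comp_mem_FP (mapSndFn_mem_FP hf) copyFn_mem_FP)
  have e : (Patch.patchT n₀ g).eval ∘ (mapSndFn f ∘ copyFn) = g := by
    funext z
    rw [Function.comp_apply, Function.comp_apply, patchT_eval_mapSndFn_copyFn]
    split
    · rfl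
    · exact (hfg z (by omega)).symm
  rwa [e] at h

end Literature.Computability.Complexity
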